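import Summits.BirchSwinnertonDyer.BirchSwinnertonDyer.Theorems.EisensteinPrimesTwistDeformationShapiroUnramified
import Literature.NumberTheory.EllipticCurves.BigRepModuleShapiroLocalConditionsProofs
import Literature.NumberTheory.GaloisRepresentations.AbsGaloisGroupCompact
import Literature.NumberTheory.IwasawaTheory.Greenberg2006.CoinducedModuleDual
import HarnessLib

/-!
# Route `EisensteinPrimes` (rung K5), crux 2 `GoodLatticeBDPValue`, line `halves` v7, stub
# `stub_shapiroBridgePure` (K-Sh), brick F2: LOCAL SHAPIRO IN TWO VARIABLES — `loc_w [c] = 0` iff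
# every evaluation `d ↦ c(d)(x)(y)` is a coboundary on `Γ_{K_w} ∩ Gal(K̄/K̃_∞)`
# (helper for stmt-BirchSwinnertonDyer-19032)

Cell `bsd-eis`, seat `bsd-eis-k5-c2` (gen 9). As `twistDeformation = bigRep κ̄₁ (bigRep κ̄₂ ρ₀)`
(`indRep₂`), cell bsd-stepL's PROVED one-variable LOCAL Shapiro criterion
`BigRepModuleShapiroLocalConditionsProofs.exists_eq_bigRep_sub_of_forall_apply` (a continuous cocycle of
`bigRep κ ρ` on a COMPACT group all of whose evaluations are coboundaries on `ker κ` is a coboundary;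
both decomposition types — `κ(D) = 0` or open — at once) applies twice and gives, for a compact `D`
mapping to `G` by `ψ` (a decomposition group `Γ_{K_w} → G_{K,S}`):

* §1 (generic) **`indRep₂_exists_eq_sub_comp_iff`**: a continuous cocycle `c` of `indRep₂ κ₁ κ₂ ρ`
  becomes a coboundary on `D` IFF for all `(x, y) ∈ ℤ_p²` the evaluation `d ↦ c(ψ d)(x)(y)` is a
  coboundary of `ρ` on `{d : κ₁(ψ d) = κ₂(ψ d) = 0}` (the places of `K̃_∞` above `w`, all at once);
* §2 (the instance) **`loc_oneCocycleClass_eq_zero_iff_forall_apply`**: Greenberg's local condition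
  `loc_w [c] = 0` of `S_𝓛(K, 𝐃)` at a place `w` of `K` ⟺ the family of these evaluation conditions on
  `Γ_{K_w}` — the two-variable form of [SU14] (3.1.2.a)–(3.1.2.b) / [Gr4] p. 342 L15–17 ("a similar
  comparison theorem for the local Galois cohomology groups which is compatible with … theorem 3").

With `…ShapiroCocycle.apply_coord_eq_conj_apply_zero` (p529197: evaluation at `κ(σ)` = conjugation by
`σ`) these evaluation classes are the restrictions of the conjugates `conjH1 σ (sh c)` to
`pairKer ⊓ D_w` — i.e. LOCAL TRIVIALITY of Rubin's class at the places of `K̃_∞` above `w`; turning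
Rubin's UNRAMIFIED condition into local triviality at `w ∈ S ∖ {v}` is the arithmetic brick F5.
Theorems only; no definition, no named fact, no instance, no `sorry`. HONEST FRAMING: closes nothing
by itself (`--supports`).
References: [SkinnerUrban2014] §3.1.2, Prop. 3.2.3; [Greenberg2006] p. 342 L15–17;
[SerreGaloisCohomology1997] I §2.5.
-/

set_option autoImplicit false
set_option linter.dupNamespace false

noncomputable section

open scoped Classical
open NumberField IsDedekindDomain Field PowerSeries Multiplicative
open Literature.NumberTheory.EllipticCurves Literature.NumberTheory.GaloisRepresentations
  Literature.NumberTheory.IwasawaTheory.Greenberg2006 Literature.NumberTheory.IwasawaTheory.Greenberg2016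

namespace Summit.BirchSwinnertonDyer.BirchSwinnertonDyer.Theorems.GreenbergFullAtSelmer

/-! ## §1. Generic: the local criterion for `indRep₂ κ₁ κ₂ ρ = bigRep κ₁ (bigRep κ₂ ρ)` -/

section Generic

variable {p : ℕ} [Fact p.Prime] {𝒪 : Type} [CommRing 𝒪] [TopologicalSpace 𝒪]
  {A : Type} [AddCommGroup A] [Module 𝒪 A] [TopologicalSpace A] [DiscreteTopology A]
  [TopologicalSpace (PowerSeries 𝒪)] [TopologicalSpace (PowerSeries (PowerSeries 𝒪))]
  {G : Type} [Group G] [TopologicalSpace G] [IsTopologicalGroup G]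
  (κ₁ κ₂ : G →ₜ* Multiplicative ℤ_[p]) (ρ : ContinuousRep G 𝒪 A)

/-- **Two-variable local Shapiro criterion on a compact group.** A continuous cocycle `c` of
`indRep₂ κ₁ κ₂ ρ` on a COMPACT `D` (acting through `κ₁, κ₂, ρ`) is a coboundary iff every evaluation
`d ↦ c(d)(x)(y)` is a coboundary of `ρ` on `ker κ₁ ⊓ ker κ₂` — the one-variable criterion applied to
the outer variable on `D` and to the inner variable on `ker κ₁`. [cite: SkinnerUrban2014, §3.1.2 ((3.1.2.a)–(3.1.2.b)) and Prop. 3.2.3 (proof)]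
[cite: SerreGaloisCohomology1997, I §2.5] -/
theorem indRep₂_exists_eq_sub_iff_forall_apply [CompactSpace G]
    (hA : ∀ a : A, ∃ k : ℕ, p ^ k • a = 0)
    {c : G → IndModule₂ 𝒪 p A} (hcont : Continuous c)
    (hc : ∀ g h : G, c (g * h) = c g + indRep₂ κ₁ κ₂ ρ g (c h)) :
    (∃ Φ : IndModule₂ 𝒪 p A, ∀ g : G, c g = indRep₂ κ₁ κ₂ ρ g Φ - Φ) ↔
      ∀ x y : ℤ_[p], ∃ a : A, ∀ h : G, κ₁ h = 1 → κ₂ h = 1 → c h x y = ρ h a - a := by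
  constructor
  · rintro ⟨Φ, hΦ⟩ x y
    refine ⟨Φ x y, fun h h₁ h₂ ↦ ?_⟩
    rw [hΦ h, BigRepModule.sub_apply, BigRepModule.sub_apply, indRep₂_apply, h₁, h₂, toAdd_one,
      sub_zero, sub_zero]
  · intro h
    -- inner step on `G₁ = ker κ₁`, for each outer value `x`
    set G₁ : Subgroup G := κ₁.toMonoidHom.ker with hG₁
    have hmem : ∀ g : G, g ∈ G₁ ↔ κ₁ g = 1 := fun g ↦ MonoidHom.mem_ker
    have hcl : IsClosed (G₁ : Set G) := by
      rw [hG₁, MonoidHom.coe_ker]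
      exact isClosed_singleton.preimage κ₁.continuous
    haveI : CompactSpace G₁ := isCompact_iff_compactSpace.mp hcl.isCompact
    let ι : G₁ →ₜ* G := ⟨G₁.subtype, continuous_subtype_val⟩
    have hSh : ∀ x : ℤ_[p], ∃ Φ₁ : BigRepModule 𝒪 p A, ∀ g : G, κ₁ g = 1 →
        c g x = bigRep κ₂ ρ g Φ₁ - Φ₁ := by
      intro x
      have hcont₁ : Continuous fun g : G₁ ↦ (c g x : BigRepModule 𝒪 p A) :=
        (continuous_of_discreteTopology (f := fun Φ : IndModule₂ 𝒪 p A ↦ (Φ x : BigRepModule 𝒪 p A))).comp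
          (hcont.comp continuous_subtype_val)
      have hc₁ : ∀ g g' : G₁, (fun g : G₁ ↦ (c g x : BigRepModule 𝒪 p A)) (g * g') =
          (fun g : G₁ ↦ (c g x : BigRepModule 𝒪 p A)) g +
            bigRep (κ₂.comp ι) (ρ.restrict ι) g ((fun g : G₁ ↦ (c g x : BigRepModule 𝒪 p A)) g') := by
        intro g g'
        show c ((g : G) * g') x = c g x + bigRep κ₂ ρ (g : G) (c g' x)
        rw [hc, BigRepModule.add_apply]
        change c g x + (bigRep κ₂ ρ (g : G)) ((c g') (x - (κ₁ (g : G)).toAdd)) = _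
        rw [(hmem g).mp g.2, toAdd_one, sub_zero]
      obtain ⟨Φ₁, hΦ₁⟩ := BigRepModule.exists_eq_bigRep_sub_of_forall_apply (κ₂.comp ι) (ρ.restrict ι)
        hA hcont₁ hc₁ (fun y ↦ by
          obtain ⟨a, ha⟩ := h x y
          exact ⟨a, fun g hg ↦ ha g ((hmem g).mp g.2) hg⟩)
      exact ⟨Φ₁, fun g hg ↦ hΦ₁ ⟨g, (hmem g).mpr hg⟩⟩
    -- outer step on `G`
    exact BigRepModule.exists_eq_bigRep_sub_of_forall_apply κ₁ (bigRep κ₂ ρ)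
      (fun Φ ↦ BigRepModule.exists_pow_nsmul_eq_zero Φ) hcont hc hSh

/-- **… along a continuous homomorphism `ψ : D → G` from a compact group** (a decomposition group):
`c ∘ ψ` is a coboundary iff all evaluations `d ↦ c(ψ d)(x)(y)` are coboundaries of `ρ` on
`{d : κ₁(ψ d) = κ₂(ψ d) = 0}`. [cite: SkinnerUrban2014, §3.1.2 ((3.1.2.a)–(3.1.2.b)) and Prop. 3.2.3 (proof)] -/
theorem indRep₂_exists_eq_sub_comp_iff {D : Type} [Group D] [TopologicalSpace D]
    [IsTopologicalGroup D] [CompactSpace D] (ψ : D →ₜ* G)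
    (hA : ∀ a : A, ∃ k : ℕ, p ^ k • a = 0)
    {c : G → IndModule₂ 𝒪 p A} (hcont : Continuous c)
    (hc : ∀ g h : G, c (g * h) = c g + indRep₂ κ₁ κ₂ ρ g (c h)) :
    (∃ Φ : IndModule₂ 𝒪 p A, ∀ d : D, c (ψ d) = indRep₂ κ₁ κ₂ ρ (ψ d) Φ - Φ) ↔
      ∀ x y : ℤ_[p], ∃ a : A, ∀ d : D, κ₁ (ψ d) = 1 → κ₂ (ψ d) = 1 →
        c (ψ d) x y = ρ (ψ d) a - a := by
  have hc' : ∀ d e : D, (c ∘ ψ) (d * e) =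
      (c ∘ ψ) d + indRep₂ (κ₁.comp ψ) (κ₂.comp ψ) (ρ.restrict ψ) d ((c ∘ ψ) e) := by
    intro d e
    show c (ψ (d * e)) = c (ψ d) + indRep₂ κ₁ κ₂ ρ (ψ d) (c (ψ e))
    rw [map_mul, hc]
  exact indRep₂_exists_eq_sub_iff_forall_apply (κ₁.comp ψ) (κ₂.comp ψ) (ρ.restrict ψ) hA
    (hcont.comp ψ.continuous) hc'

end Generic

/-! ## §2. The instance: Greenberg's `loc_w` for `𝐃 = twistDeformation S hS κ₁ κ₂ ρ₀` -/

section Twist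

variable {K : Type} [Field K] [NumberField K] {S : Set (HeightOneSpectrum (𝓞 K))} {p : ℕ}
  [Fact p.Prime] {𝒪 : Type} [CommRing 𝒪] [TopologicalSpace 𝒪]
  {A : Type} [AddCommGroup A] [Module 𝒪 A] [TopologicalSpace A] [DiscreteTopology A]
  [TopologicalSpace (PowerSeries 𝒪)] [TopologicalSpace (PowerSeries (PowerSeries 𝒪))]
  [IsTopologicalAddGroup (IndModule₂ 𝒪 p A)]
  [ContinuousSMul (PowerSeries (PowerSeries 𝒪)) (IndModule₂ 𝒪 p A)]
  (hS : ∀ v : HeightOneSpectrum (𝓞 K), ((p : ℕ) : 𝓞 K) ∈ v.asIdeal → v ∈ S)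
  (κ₁ κ₂ : ZpExtension K p) (ρ₀ : ContinuousRep (GaloisGroupUnramifiedOutside K S) 𝒪 A)

/-- **Greenberg's local condition under Shapiro, two variables.** For a place `w` of `K` and a
continuous crossed homomorphism `c : G_{K,S} → 𝐃`: `loc_w [c] = 0` (the condition of `S_{𝓛_v}(K, 𝐃)` at
`w ≠ v`) IFF for every `(x, y) ∈ ℤ_p²` the evaluation `τ ↦ c(τ̄)(x)(y)` is a coboundary of `ρ₀` on the
elements of `Γ_{K_w}` lying over `Gal(K̄/K̃_∞)` (`κ̄₁ τ̄ = κ̄₂ τ̄ = 0`) — the family of LOCAL TRIVIALITY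
conditions at the places of `K̃_∞` above `w`. [cite: Greenberg2006, p. 342 L15–17] [cite: SkinnerUrban2014, §3.1.2 ((3.1.2.a)–(3.1.2.b))] -/
theorem loc_oneCocycleClass_eq_zero_iff_forall_apply (hA : ∀ a : A, ∃ k : ℕ, p ^ k • a = 0)
    (w : Place K) (c : contOneCocycles (twistDeformation S hS κ₁ κ₂ ρ₀).toTopRep) :
    loc S (twistDeformation S hS κ₁ κ₂ ρ₀) w 1
        (oneCocycleClass (twistDeformation S hS κ₁ κ₂ ρ₀).toTopRep c) = 0 ↔
      ∀ x y : ℤ_[p], ∃ a : A, ∀ τ : absoluteGaloisGroup w.Completion,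
        κ₁.liftUnramifiedOutside S hS (localToUnramified S w τ) = 1 →
        κ₂.liftUnramifiedOutside S hS (localToUnramified S w τ) = 1 →
          c.1 (localToUnramified S w τ) x y = ρ₀ (localToUnramified S w τ) a - a := by
  haveI : CompactSpace (absoluteGaloisGroup w.Completion) := absoluteGaloisGroup_compactSpace _
  have hc : ∀ g h : GaloisGroupUnramifiedOutside K S,
      c.1 (g * h) = c.1 g + twistDeformation S hS κ₁ κ₂ ρ₀ g (c.1 h) := c.2
  rw [loc_oneCocycleClass_eq_zero_iff]
  exact indRep₂_exists_eq_sub_comp_iff (κ₁.liftUnramifiedOutside S hS) (κ₂.liftUnramifiedOutside S hS)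
    ρ₀ (localToUnramified S w) hA c.1.continuous hc

end Twist

end Summit.BirchSwinnertonDyer.BirchSwinnertonDyer.Theorems.GreenbergFullAtSelmer

end
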